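import Literature.AlgebraicGeometry.CossartPiltant200819.GoodResolutionOneBlowupQuasiExcellent2019
import Literature.AlgebraicGeometry.Resolution.EmbeddedResolutionExcellentSurfacesSequence
import HarnessLib

/-!
# Embedded snc-ification of a closed subset of a regular excellent threefold by ONE supported blowing up
# (crux `FInjectiveMacaulayfication` stmt-ResolutionOfSingularities-15315, chain w45a; task (C) STEP 2, RULING R15.36 (2) / R15.38)

[OURS · L1 W4.5a · res-L1-w45a-lead-1] Helper theorem toward the residual-class census (ThmD-≤3 = THEOREM-D programme,
STEP 2 of `gdd_of_isolatedSingularity_dimThree_of`); NOT a door rung, NOT a statement of any manuscript; AI-written, weaker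
than expert review.  KNOWN assembly (Cossart–Piltant 2019 Prop. 4.4 + Cossart–Jannsen–Saito 2020 Thm. 1.4) modulo the two
named facts BY NAME, following word for word the tree's `CP2019.exists_isBlowup_isGoodResolution_support_eq_of_dim_three_of_isQuasiExcellent`
(`GoodResolutionOneBlowupQuasiExcellent2019.lean`) with the singular locus replaced by an arbitrary closed `B ≠ Z`:

* `embeddedSncThreefolds_of (hP) (hCJS)` — for `Z` integral Noetherian regular excellent with `dim Z = 3` and `B ⊊ Z` closed there
  are `𝓛 ≠ 0` with `Supp 𝓛 ⊆ B` and ONE blowing up `ρ : Z' → Z` along `𝓛` with `Z'` regular and `ρ⁻¹ B` a strict normal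
  crossings divisor.  Proof: `I_B := vanishingIdeal B ≠ 0`; `hP` principalizes `I_B` by a regular-centre sequence `σ : S' → Z`
  (one blowing up along `𝓚`, `Supp 𝓚 ⊆ B`; `S'` regular, excellent, integral, `dim S' = 3`; `I_B𝒪_{S'}` an effective Cartier
  divisor with support `D = σ⁻¹B ⊊ S'`, `dim D ≤ 2`); CJS Thm. 1.4 (`B = ∅`, via `CossartJannsenSaito2020EmbeddedSequenceB.embedded`
  and `.of_isClosed`) on `D ⊆ S'`: `π : Z₁ → S'` one blowing up along `Q`, `Supp Q ⊆ D`, `Z₁` regular, `π⁻¹D = X₁ ∪ B₁`, `B₁` snc,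
  `X₁` transversal to `B₁`; `X₁ ∪ B₁ = Supp (I_B𝒪_{Z₁})` is the support of an effective Cartier divisor
  (`IsEffectiveCartier.comap_of_isBlowup`), so the union is snc (`IsTransversalWith.isStrictNormalCrossingsDivisor_union`);
  `π ≫ σ` is one blowing up supported in `B` (`IsBlowup.exists_isBlowup_comp_supported`).
-/

-- single-problem summit: the doubled namespace component is forced
set_option linter.dupNamespace false
set_option autoImplicit false

noncomputable section

open CategoryTheory CategoryTheory.Limits AlgebraicGeometry TopologicalSpace IsLocalRing
open Literature.AlgebraicGeometry.Resolution Literature.AlgebraicGeometry.CossartPiltant200819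
open Literature.AlgebraicGeometry.CossartPiltant200819.CP2019
open Scheme.IdealSheafData

namespace Summit.ResolutionOfSingularities.ResolutionOfSingularities.Theorems.FInjectiveMacaulayfication.EmbeddedSncThreefolds

universe u

/-- **Embedded snc-ification of a closed proper subset of a regular excellent integral threefold by ONE blowing up supported on
it.**  For `Z` integral, Noetherian, regular, excellent of dimension three and `B ⊆ Z` closed with `B ≠ Z`, there are an ideal
sheaf `𝓛 ≠ 0` with `Supp 𝓛 ⊆ B` and a blowing up `ρ : Z' → Z` along `𝓛` such that `Z'` is regular and `ρ⁻¹(B)` is a strict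
normal crossings divisor — given Cossart–Piltant 2019 Prop. 4.4 (`CossartPiltant2019Principalization`) and Cossart–Jannsen–Saito
2020 Thm. 1.4 (`CossartJannsenSaito2020EmbeddedSequenceB`).  (`B.Nonempty` is not needed and not assumed.)
[OURS · L1 W4.5a helper; KNOWN assembly; cite: CossartPiltant2019, Prop. 4.4 and §4.1 (v1 p. 50); CossartJannsenSaito2020, Thm. 1.4, Cor. 1.5] -/
theorem embeddedSncThreefolds_of (hP : CossartPiltant2019Principalization.{u})
    (hCJS : CossartJannsenSaito2020EmbeddedSequenceB.{u})
    (Z : Scheme.{u}) [IsIntegral Z] [IsNoetherian Z] (hZreg : Scheme.IsRegular Z) (hZexc : Scheme.IsExcellent Z)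
    (hdimZ : topologicalKrullDim Z = 3) (B : Set Z) (hB : IsClosed B) (hBuniv : B ≠ Set.univ) :
    ∃ (𝓛 : Z.IdealSheafData) (Z' : Scheme.{u}) (ρ : Z' ⟶ Z),
      𝓛 ≠ ⊥ ∧ (𝓛.support : Set Z) ⊆ B ∧ IsBlowup ρ 𝓛 ∧ Scheme.IsRegular Z' ∧
        IsStrictNormalCrossingsDivisor Z' (ρ ⁻¹' B) := by
  classical
  have hE : CossartJannsenSaito2020Embedded.{u} := hCJS.embedded
  -- a point off `B`
  obtain ⟨z₀, hz₀⟩ : ∃ z₀ : Z, z₀ ∉ B := Set.ne_univ_iff_exists_notMem _ |>.mp hBuniv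
  -- (1) the reduced ideal sheaf of `B`, non-zero
  set T : Closeds Z := ⟨B, hB⟩ with hTdef
  set I : Z.IdealSheafData := vanishingIdeal T with hIdef
  have hIsupp : (I.support : Set Z) = B := Scheme.IdealSheafData.coe_support_vanishingIdeal T
  have hIne : I ≠ ⊥ := by
    intro h0
    have hmem : z₀ ∈ (I.support : Set Z) := by rw [h0, support_bot]; trivial
    rw [hIsupp] at hmem
    exact hz₀ hmem
  -- (2) principalization of `I` (CP Prop. 4.4): `σ : S' → Z`
  obtain ⟨S', σ, hseq, hprinc⟩ := hP Z hZreg hZexc hdimZ I hIne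
  haveI : IsIntegral S' := hseq.isIntegral hIne
  haveI : IsNoetherian S' := hseq.isNoetherian inferInstance
  have hS'reg : Scheme.IsRegular S' := hseq.isRegular hZreg
  have hcart : IsEffectiveCartier (I.comap σ) :=
    hprinc.isEffectiveCartier_of_ne_bot
      (hseq.isIntegral_and_comap_ne_bot inferInstance inferInstance hIne).2.2
  -- `σ` is one blowing up along `𝓚`, `Supp 𝓚 ⊆ Supp I = B`
  obtain ⟨𝓚, h𝓚, h𝓚supp⟩ := hseq.exists_isBlowup_supported inferInstance
  have h𝓚B : (𝓚.support : Set Z) ⊆ B := hIsupp ▸ h𝓚supp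
  have h𝓚ne : 𝓚 ≠ ⊥ := by
    intro h0
    have hmem : z₀ ∈ (𝓚.support : Set Z) := by rw [h0, support_bot]; trivial
    exact hz₀ (h𝓚B hmem)
  haveI : IsProper σ := h𝓚.isProper
  have hexcS' : Scheme.IsExcellent S' :=
    isExcellent_of_isRegular_of_isQuasiExcellent hS'reg
      (Scheme.IsQuasiExcellent.of_locallyOfFiniteType σ hZexc.isQuasiExcellent)
  have hdimS' : topologicalKrullDim S' = 3 :=
    (h𝓚.isBirational' h𝓚ne).topologicalKrullDim_eq_of_isProper.trans hdimZ
  -- (3) `D = σ⁻¹ B`: closed, not everything, of dimension `≤ 2`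
  set D : Set S' := σ ⁻¹' B with hDdef
  have hD : IsClosed D := hB.preimage σ.continuous
  have hDne : D ≠ Set.univ := by
    let W : Z.Opens := ⟨(𝓚.support : Set Z)ᶜ, 𝓚.support.isClosed.isOpen_compl⟩
    haveI : IsIso (σ ∣_ W) := h𝓚.isIso_compl
    have hz₀W : z₀ ∈ (W : Set Z) := fun h => hz₀ (h𝓚B h)
    obtain ⟨s, hs⟩ := (ConcreteCategory.bijective_of_isIso (σ ∣_ W).base).2 ⟨z₀, hz₀W⟩
    have hsz : σ s.1 = z₀ := by
      have h1 := congrArg Subtype.val hs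
      rwa [morphismRestrict_base_coe] at h1
    intro hD'
    have hmem : s.1 ∈ D := hD' ▸ Set.mem_univ _
    rw [hDdef, Set.mem_preimage, hsz] at hmem
    exact hz₀ hmem
  have hdimD : topologicalKrullDim D ≤ 2 := by
    have hlt := Literature.Topology.topologicalKrullDim_lt_of_isClosed_ssubset hD hDne (2 + 1)
      (by rw [hdimS']; exact_mod_cast (by norm_num : (3 : ℕ) < 2 + 1 + 1))
    rw [Nat.cast_add_one] at hlt
    exact_mod_cast (ENat.WithBot.lt_add_one_iff.mp hlt)
  -- (4) CJS: embedded resolution of `D ⊆ S'`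
  obtain ⟨Z₁, π, X₁, B₁, hT, hZ₁reg, -, -, -, -, hB₁, htot, htr⟩ :=
    hE.of_isClosed S' hS'reg hexcS' D hD hdimD
  have hX₁c : IsClosed X₁ := hT.isClosed_transform hD
  -- `π` is one blowing up along `Q`, `Supp Q ⊆ D`; `π ≫ σ` is one blowing up along `𝓛`, `Supp 𝓛 ⊆ B`
  obtain ⟨Q, hQ, hQD⟩ := hT.exists_isBlowup
  obtain ⟨𝓛, h𝓛, h𝓛supp⟩ :=
    IsBlowup.exists_isBlowup_comp_supported σ 𝓚 π Q B h𝓚 h𝓚B hQ hQD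
  have h𝓛ne : 𝓛 ≠ ⊥ := by
    intro h0
    have hmem : z₀ ∈ (𝓛.support : Set Z) := by rw [h0, support_bot]; trivial
    exact hz₀ (h𝓛supp hmem)
  -- (5) `X₁ ∪ B₁ = π⁻¹ D = Supp (I𝒪_{Z₁})` is the support of an effective Cartier divisor
  have hcart₁ : IsEffectiveCartier ((I.comap σ).comap π) :=
    IsEffectiveCartier.comap_of_isBlowup hQ hcart
  have hcl : (⟨closure (X₁ ∪ B₁), isClosed_closure⟩ : Closeds Z₁) = ((I.comap σ).comap π).support := by
    apply Closeds.ext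
    change closure (X₁ ∪ B₁) = (((I.comap σ).comap π).support : Set Z₁)
    rw [(hX₁c.union hB₁.isClosed).closure_eq, support_comap, Closeds.coe_preimage, support_comap,
      Closeds.coe_preimage, hIsupp, ← htot, hDdef]
  have hsnc : IsStrictNormalCrossingsDivisor Z₁ (X₁ ∪ B₁) := by
    refine htr.isStrictNormalCrossingsDivisor_union hB₁ hX₁c fun x _ => ?_
    obtain ⟨t, ht, hst⟩ := hcart₁.exists_stalkIdeal_eq_span x
    refine ⟨t, nonZeroDivisors.ne_zero ht, ?_⟩
    rw [hcl, vanishingIdeal_support, stalkIdeal_radical, hst]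
  -- (6) read off
  have hpre : (π ≫ σ) ⁻¹' B = X₁ ∪ B₁ := by
    rw [← htot, hDdef]
    ext x
    simp only [Set.mem_preimage, Scheme.Hom.comp_apply]
  exact ⟨𝓛, Z₁, π ≫ σ, h𝓛ne, h𝓛supp, h𝓛, hZ₁reg, hpre ▸ hsnc⟩

end Summit.ResolutionOfSingularities.ResolutionOfSingularities.Theorems.FInjectiveMacaulayfication.EmbeddedSncThreefolds

end
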